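import Mathlib

/-!
# The time-reversal symmetrisation bound behind the Fröhlich–Spencer lower bound

Abstract form of the one inequality that carries the lower bound on the two-point function in the
Fröhlich–Spencer treatment of the Villain model / Coulomb gas ([FS82, §5]; in the form of
Bauerschmidt–Conache–Heydenreich–Merkl–Rolles, arXiv:1811.12812, Lemma 11), stated for an ARBITRARY
measure-preserving symmetry of the field together with a re-indexing of the polymers, instead of the
field reflection `φ ↦ -φ`.

Setting. A finite index set `ι` ("polymers"), real activities `z : ι → ℝ` (no sign assumption),
"angles" `A : ι → ℝ` (in the application `A_I(φ) = 2π(I, φ + σ_bg)` with `σ_bg` a background field)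
and "sources" `s : ι → ℝ` (in the application `s_I = 2π(I, σ_ρ)`, the coupling of the order-parameter
insertion). The sine-Gordon-type exponent is `Φ_s(A) = ∑ I, z_I cos (A_I + s_I)`.

* `SoloInformed.exp_sum_cos_symm_ge` (pointwise):
  `e^{-½ ∑|z_I| s_I²} e^{Φ_0(A)} ≤ ½ (e^{Φ_s(A)} + e^{Φ_{-s}(A)})`
  — write `Φ_{±s} = Φ_0 + P ± Q` with `P = ∑ z cos A (cos s - 1) ≥ -½∑|z|s²`, and use `cosh Q ≥ 1`.
* `SoloInformed.sum_cos_reindex`: if a bijection `Θ` of `ι` fixes `z` and the transformed angles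
  satisfy `cos (A'_I + s_I) = cos (A_{ΘI} - s_{ΘI})` (e.g. `A'_I ≡ A_{ΘI}` and `s_I ≡ -s_{ΘI}` mod `2π`,
  `SoloInformed.cos_congr_of_int`), then `Φ_s(A') = Φ_{-s}(A)`.
* `SoloInformed.lintegral_exp_sum_cos_ge` (the bound): for a measure `μ` on `Ω`, measurable angle maps
  `A : Ω → ι → ℝ`, and a measure-preserving `T : Ω → Ω` with `Φ_s(A(Tω)) = Φ_{-s}(A(ω))`,
  `e^{-½∑|z_I| s_I²} ∫⁻ e^{Φ_0(A)} dμ ≤ ∫⁻ e^{Φ_s(A)} dμ`;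
  `SoloInformed.lintegral_exp_sum_cos_ge_of_reindex` takes the symmetry as a re-indexing bijection
  with congruences mod `2π`.

In [BCHMR19, Lemma 11] `T` is `φ ↦ -φ` and `Θ = id` (this needs the background to be reflection-odd,
i.e. absent or half-integral). In the accompanying note (`paper/villain-lro.md` of the soloist folder
solo-AtomisticToContinuum-informed) `T` is bosonic TIME REVERSAL `φ ↦ -T^*φ` and `Θ I = -T^*I`: the
density background of the Villain `J`-current lattice boson model at ANY filling is `Θ`-even while an
equal-time insertion is `Θ`-odd, which is exactly the hypothesis of `lintegral_exp_sum_cos_ge`; the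
conclusion is the equal-time long-range-order lower bound at every density, given the Fröhlich–Spencer
representation (cited there, not formalised). No positivity of the activities is used.
[folklore inequality; the content is the hypothesis set] [cite: FroehlichSpencer1982, §5; BCHMR2019, Lemma 11]
-/

open MeasureTheory
open scoped BigOperators ENNReal

namespace SoloInformed

variable {ι : Type*} [Fintype ι]

/-- `e^X ≤ ½ (e^{X+Q} + e^{X-Q})` (`cosh Q ≥ 1`). -/
theorem exp_le_half_exp_add_exp_sub (X Q : ℝ) :
    Real.exp X ≤ (Real.exp (X + Q) + Real.exp (X - Q)) / 2 := by
  have h : (Real.exp (X + Q) + Real.exp (X - Q)) / 2 = Real.exp X * Real.cosh Q := by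
    rw [Real.cosh_eq, Real.exp_add, sub_eq_add_neg, Real.exp_add]
    ring
  rw [h]
  have hx : 0 < Real.exp X := Real.exp_pos X
  nlinarith [Real.one_le_cosh Q]

/-- `z cos A (cos s - 1) ≥ -|z| s² / 2`. -/
theorem mul_cos_mul_cos_sub_one_ge (z A s : ℝ) :
    -(|z| * s ^ 2 / 2) ≤ z * Real.cos A * (Real.cos s - 1) := by
  have h1 : 0 ≤ 1 - Real.cos s := by linarith [Real.cos_le_one s]
  have h2 : 1 - Real.cos s ≤ s ^ 2 / 2 := by linarith [Real.one_sub_sq_div_two_le_cos (x := s)]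
  have h3 : |z * Real.cos A| ≤ |z| := by
    rw [abs_mul]
    exact mul_le_of_le_one_right (abs_nonneg z) (Real.abs_cos_le_one A)
  have h5 : z * Real.cos A * (Real.cos s - 1) = -(z * Real.cos A) * (1 - Real.cos s) := by ring
  rw [h5]
  have h6 : -(z * Real.cos A) * (1 - Real.cos s) ≥ -|z| * (1 - Real.cos s) := by
    have : -(z * Real.cos A) ≥ -|z| := by linarith [le_abs_self (z * Real.cos A)]
    exact mul_le_mul_of_nonneg_right this h1
  have h7 : -|z| * (1 - Real.cos s) ≥ -|z| * (s ^ 2 / 2) :=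
    mul_le_mul_of_nonpos_left h2 (by linarith [abs_nonneg z])
  linarith

/-- POINTWISE SYMMETRISATION BOUND: `e^{-½∑|z|s²} e^{Φ_0} ≤ ½ (e^{Φ_s} + e^{Φ_{-s}})` for
`Φ_s = ∑ I, z I cos (A I + s I)`. -/
theorem exp_sum_cos_symm_ge (z A s : ι → ℝ) :
    Real.exp (-(∑ i, |z i| * s i ^ 2 / 2)) * Real.exp (∑ i, z i * Real.cos (A i)) ≤
      (Real.exp (∑ i, z i * Real.cos (A i + s i)) + Real.exp (∑ i, z i * Real.cos (A i - s i))) / 2 := by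
  -- decomposition Φ_{±s} = Φ_0 + P ± Q
  set Φ₀ : ℝ := ∑ i, z i * Real.cos (A i) with hΦ₀
  set P : ℝ := ∑ i, z i * Real.cos (A i) * (Real.cos (s i) - 1) with hP
  set Q : ℝ := -(∑ i, z i * Real.sin (A i) * Real.sin (s i)) with hQ
  have hs : ∑ i, z i * Real.cos (A i + s i) = Φ₀ + P + Q := by
    simp only [hΦ₀, hP, hQ, Real.cos_add]
    rw [← Finset.sum_add_distrib, ← Finset.sum_neg_distrib, ← Finset.sum_add_distrib]
    refine Finset.sum_congr rfl fun i _ => ?_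
    ring
  have hms : ∑ i, z i * Real.cos (A i - s i) = Φ₀ + P - Q := by
    simp only [hΦ₀, hP, hQ, Real.cos_sub, sub_neg_eq_add]
    rw [← Finset.sum_add_distrib, ← Finset.sum_add_distrib]
    refine Finset.sum_congr rfl fun i _ => ?_
    ring
  rw [hs, hms]
  have hPge : -(∑ i, |z i| * s i ^ 2 / 2) ≤ P := by
    rw [hP, ← Finset.sum_neg_distrib]
    exact Finset.sum_le_sum fun i _ => mul_cos_mul_cos_sub_one_ge (z i) (A i) (s i)
  calc Real.exp (-(∑ i, |z i| * s i ^ 2 / 2)) * Real.exp Φ₀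
      ≤ Real.exp P * Real.exp Φ₀ :=
        mul_le_mul_of_nonneg_right (Real.exp_le_exp.mpr hPge) (Real.exp_pos _).le
    _ = Real.exp (Φ₀ + P) := by rw [Real.exp_add, mul_comm]
    _ ≤ (Real.exp (Φ₀ + P + Q) + Real.exp (Φ₀ + P - Q)) / 2 := exp_le_half_exp_add_exp_sub _ _

/-- Congruence mod `2π` of angle and (reversed) source gives the cosine identity used for re-indexing. -/
theorem cos_congr_of_int {a a' t t' : ℝ} (k m : ℤ) (ha : a' = a + k * (2 * Real.pi))
    (ht : t' = -t + m * (2 * Real.pi)) : Real.cos (a' + t') = Real.cos (a - t) := by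
  rw [ha, ht]
  have : a + k * (2 * Real.pi) + (-t + m * (2 * Real.pi)) =
      (a - t) + ((k + m : ℤ) : ℝ) * (2 * Real.pi) := by
    push_cast; ring
  rw [this, Real.cos_add_int_mul_two_pi]

/-- RE-INDEXING: a bijective symmetry `Θ` of the polymers fixing the activities, under which the
transformed angles-plus-sources are the `Θ`-images of angles-minus-sources, turns `Φ_s` of the
transformed angles `A'` into `Φ_{-s}` of the original ones. -/
theorem sum_cos_reindex (Θ : ι ≃ ι) (z A A' s : ι → ℝ) (hz : ∀ i, z (Θ i) = z i)
    (hA : ∀ i, Real.cos (A' i + s i) = Real.cos (A (Θ i) - s (Θ i))) :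
    ∑ i, z i * Real.cos (A' i + s i) = ∑ i, z i * Real.cos (A i - s i) := by
  have h1 : ∑ i, z i * Real.cos (A' i + s i) = ∑ i, z (Θ i) * Real.cos (A (Θ i) - s (Θ i)) := by
    refine Finset.sum_congr rfl fun i _ => ?_
    rw [hz i, hA i]
  rw [h1, Equiv.sum_comp Θ (fun j => z j * Real.cos (A j - s j))]

section Integral

variable {Ω : Type*} [MeasurableSpace Ω]

/-- Measurability of `ω ↦ e^{∑ I, z I cos (B I (ω))}` (as an `ℝ≥0∞`-valued map) for measurable angle maps. -/
theorem measurable_exp_sum_cos (z : ι → ℝ) {B : Ω → ι → ℝ} (hB : ∀ i, Measurable fun ω => B ω i) :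
    Measurable fun ω => ENNReal.ofReal (Real.exp (∑ i, z i * Real.cos (B ω i))) := by
  apply ENNReal.measurable_ofReal.comp
  apply Real.measurable_exp.comp
  refine Finset.measurable_sum _ fun i _ => ?_
  exact (Real.measurable_cos.comp (hB i)).const_mul _

/-- INTEGRATED SYMMETRISATION BOUND from an identity of the two symmetrised integrals. -/
theorem lintegral_exp_sum_cos_ge_of_symm (μ : Measure Ω) (z s : ι → ℝ) {A : Ω → ι → ℝ}
    (hA : ∀ i, Measurable fun ω => A ω i)
    (hsymm : ∫⁻ ω, ENNReal.ofReal (Real.exp (∑ i, z i * Real.cos (A ω i - s i))) ∂μ =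
      ∫⁻ ω, ENNReal.ofReal (Real.exp (∑ i, z i * Real.cos (A ω i + s i))) ∂μ) :
    ENNReal.ofReal (Real.exp (-(∑ i, |z i| * s i ^ 2 / 2))) *
        ∫⁻ ω, ENNReal.ofReal (Real.exp (∑ i, z i * Real.cos (A ω i))) ∂μ ≤
      ∫⁻ ω, ENNReal.ofReal (Real.exp (∑ i, z i * Real.cos (A ω i + s i))) ∂μ := by
  set c : ℝ := Real.exp (-(∑ i, |z i| * s i ^ 2 / 2)) with hc
  have hc0 : 0 ≤ c := (Real.exp_pos _).le
  have hmeas : Measurable fun ω => ENNReal.ofReal (Real.exp (∑ i, z i * Real.cos (A ω i + s i))) :=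
    measurable_exp_sum_cos z fun i => (hA i).add_const _
  -- multiply both sides by 2
  rw [← ENNReal.mul_le_mul_iff_right (a := (2 : ℝ≥0∞)) two_ne_zero ENNReal.ofNat_ne_top]
  have hL : (2 : ℝ≥0∞) * (ENNReal.ofReal c *
      ∫⁻ ω, ENNReal.ofReal (Real.exp (∑ i, z i * Real.cos (A ω i))) ∂μ) =
      ∫⁻ ω, ENNReal.ofReal (2 * (c * Real.exp (∑ i, z i * Real.cos (A ω i)))) ∂μ := by
    rw [← mul_assoc, ← lintegral_const_mul' _ _ (by
      exact ENNReal.mul_ne_top ENNReal.ofNat_ne_top ENNReal.ofReal_ne_top)]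
    refine lintegral_congr fun ω => ?_
    rw [ENNReal.ofReal_mul (by norm_num : (0:ℝ) ≤ 2), ENNReal.ofReal_mul hc0, ENNReal.ofReal_ofNat,
      mul_assoc]
  have hR : (2 : ℝ≥0∞) * ∫⁻ ω, ENNReal.ofReal (Real.exp (∑ i, z i * Real.cos (A ω i + s i))) ∂μ =
      ∫⁻ ω, (ENNReal.ofReal (Real.exp (∑ i, z i * Real.cos (A ω i + s i))) +
        ENNReal.ofReal (Real.exp (∑ i, z i * Real.cos (A ω i - s i)))) ∂μ := by
    rw [lintegral_add_left hmeas, hsymm, two_mul]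
  rw [hL, hR]
  refine lintegral_mono fun ω => ?_
  rw [← ENNReal.ofReal_add (Real.exp_pos _).le (Real.exp_pos _).le]
  apply ENNReal.ofReal_le_ofReal
  have h := exp_sum_cos_symm_ge z (A ω) s
  rw [← hc] at h
  linarith

/-- THE BOUND. If a measure-preserving map `T` of the field space transforms `Φ_s` into `Φ_{-s}`
(time reversal: background even, equal-time source odd), then
`e^{-½∑|z_I| s_I²} ∫⁻ e^{Φ_0} dμ ≤ ∫⁻ e^{Φ_s} dμ` — uniformly in any background hidden in `A`. -/
theorem lintegral_exp_sum_cos_ge (μ : Measure Ω) (z s : ι → ℝ) {A : Ω → ι → ℝ}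
    (hA : ∀ i, Measurable fun ω => A ω i) {T : Ω → Ω} (hT : MeasurePreserving T μ μ)
    (hΦ : ∀ ω, ∑ i, z i * Real.cos (A (T ω) i + s i) = ∑ i, z i * Real.cos (A ω i - s i)) :
    ENNReal.ofReal (Real.exp (-(∑ i, |z i| * s i ^ 2 / 2))) *
        ∫⁻ ω, ENNReal.ofReal (Real.exp (∑ i, z i * Real.cos (A ω i))) ∂μ ≤
      ∫⁻ ω, ENNReal.ofReal (Real.exp (∑ i, z i * Real.cos (A ω i + s i))) ∂μ := by
  apply lintegral_exp_sum_cos_ge_of_symm μ z s hA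
  have h1 : ∫⁻ ω, ENNReal.ofReal (Real.exp (∑ i, z i * Real.cos (A ω i - s i))) ∂μ =
      ∫⁻ ω, ENNReal.ofReal (Real.exp (∑ i, z i * Real.cos (A (T ω) i + s i))) ∂μ :=
    lintegral_congr fun ω => by rw [hΦ ω]
  rw [h1]
  exact hT.lintegral_comp (measurable_exp_sum_cos z fun i => (hA i).add_const _)

/-- The same with the symmetry given as a re-indexing bijection `Θ` of the polymers (activities
`Θ`-invariant) and pointwise congruences: `A_I ∘ T` agrees with `A_{ΘI}`, and `s_I` with `-s_{ΘI}`,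
modulo `2π`. This is the hypothesis set verified in `paper/villain-lro.md`, Lemma 3 (density
character even, equal-time worm odd under time reversal). -/
theorem lintegral_exp_sum_cos_ge_of_reindex (μ : Measure Ω) (z s : ι → ℝ) {A : Ω → ι → ℝ}
    (hA : ∀ i, Measurable fun ω => A ω i) {T : Ω → Ω} (hT : MeasurePreserving T μ μ)
    (Θ : ι ≃ ι) (hz : ∀ i, z (Θ i) = z i)
    (hAT : ∀ ω i, ∃ k : ℤ, A (T ω) i = A ω (Θ i) + k * (2 * Real.pi))
    (hs : ∀ i, ∃ m : ℤ, s i = -s (Θ i) + m * (2 * Real.pi)) :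
    ENNReal.ofReal (Real.exp (-(∑ i, |z i| * s i ^ 2 / 2))) *
        ∫⁻ ω, ENNReal.ofReal (Real.exp (∑ i, z i * Real.cos (A ω i))) ∂μ ≤
      ∫⁻ ω, ENNReal.ofReal (Real.exp (∑ i, z i * Real.cos (A ω i + s i))) ∂μ := by
  refine lintegral_exp_sum_cos_ge μ z s hA hT fun ω => ?_
  refine sum_cos_reindex Θ z (A ω) (A (T ω)) s hz fun i => ?_
  obtain ⟨k, hk⟩ := hAT ω i
  obtain ⟨m, hm⟩ := hs i
  exact cos_congr_of_int k m hk hm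

end Integral

end SoloInformed
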